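import Literature.Analysis.FluidPDE.MikadoShiftedPipes
import Literature.Analysis.FluidPDE.ZerothLawProofs
import Mathlib.MeasureTheory.Integral.IntervalIntegral.Periodic
import HarnessLib

/-!
# Axial profiles of intermittent jets: one-periodic functions pulled back along a character,
  and the factorisation of torus integrals along (axial character) × (transverse forms)

Analysis/FluidPDE support file (everything proved; no named facts) for the intermittent-jet
building blocks of Buckmaster–Colombo–Vicol / Buckmaster–Vicol (EMS Surv. Math. Sci. 6 (2019) =
arXiv:1901.09023, §7.4, (7.16a): "`ψ_(ξ)(x,t) := ψ_{r_∥}(n_* r_⊥ λ (x·ξ + μt))`", and the sentence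
after (7.19): "the directions of oscillation for the functions defined in (7.16) are orthogonal.
Therefore, we may use Fubini to combine the estimates obeyed by `ψ_(ξ)` (which is a 1D function)
and `φ_(ξ)`, `Φ_(ξ)` (which are 2D functions), to obtain estimates for the 3D functions"). On the
tree's unit torus `𝕋^d = (ℝ/ℤ)^d`, with the integer transverse data `TransverseDatum` of the
Mikado tool-kit (`TransversePullback`: forms `L : 𝕋^d →+ 𝕋^m` annihilating a lattice direction
`k`) and the characters `χ_n : 𝕋^d →+ 𝕋¹` (`Mikado.chi`, `MikadoShiftedPipes`):

* `Jet.axialFn P hP n r : 𝕋^d → ℝ`, `y ↦ P̃(χ_n y + r)` for a `1`-periodic `P : ℝ → ℝ`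
  (`P̃ = hP.lift : 𝕋¹ → ℝ`): its lift to `ℝ^d` is `Y ↦ P(n·Y + r)` (`lift_axialFn`); smoothness;
  `∂ₗ P̃(χ_n y + r) = nₗ P̃'(χ_n y + r)` (`partialDeriv_axialFn`); the derivative in the phase `r`
  (`hasDerivAt_axialFn_phase`); joint smoothness of `(t, y) ↦ P̃(χ_n y + ωt)`;
* the **joint homomorphism** `Jet.jointHom T n : 𝕋^d →+ 𝕋¹ × 𝕋^m`, `y ↦ (χ_n y, L y)`: continuous,
  surjective as soon as `n·k ≠ 0` (move along the direction `k`, which `L` does not see), hence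
  pushing the Haar probability measure to the Haar probability measure (`map_jointHom_volume`);
* the **factorisation** `∫_{𝕋^d} F(χ_n y) G(L y) dy = (∫_{𝕋¹} F)(∫_{𝕋^m} G)`
  (`integral_axial_mul_transverse`) and `∫_{𝕋¹} F(P̃ s) ds = ∫₀¹ F(P s) ds`
  (`integral_comp_lift_eq_intervalIntegral`), whence
  `∫_{𝕋^d} F(P̃(χ_n y + r)) G(L y) dy = (∫₀¹ F ∘ P)(∫_{𝕋^m} G)` (`integral_axialFn_mul_pull`).

## References

* T. Buckmaster, V. Vicol, EMS Surv. Math. Sci. 6 (2019) = arXiv:1901.09023, §7.4 (7.16)–(7.24).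
  [`BuckmasterVicol2020`]
* T. Buckmaster, M. Colombo, V. Vicol, J. Eur. Math. Soc. 24 (2022) = arXiv:1809.00600, §2
  (intermittent jets). [`BuckmasterColomboVicol2022`]
-/

noncomputable section

open MeasureTheory Set Function UnitAddTorus
open scoped ContDiff

namespace Literature.Analysis.FluidPDE

namespace Jet

open FunctionSpaces FunctionSpaces.Torus Mikado

variable {d : Type*} [Fintype d] [DecidableEq d]

/-! ## One-periodic functions on the circle and along a character -/

section Axial

variable {P : ℝ → ℝ}

omit [Fintype d] [DecidableEq d] in
/-- The lift `P̃ : 𝕋¹ → ℝ` of a `1`-periodic function evaluated on representatives. [folklore] -/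
theorem lift_coe_apply (hP : Periodic P 1) (x : ℝ) : hP.lift (x : UnitAddCircle) = P x := rfl

/-- **The axial function** `y ↦ P̃(χ_n y + r)` on `𝕋^d` of a `1`-periodic `P`, a lattice vector
`n ∈ ℤ^d` and a real phase `r` (BV 2019 survey (7.16a) with `n = n_* r_⊥ λ ξ`, `r = n_* r_⊥ λ μ t`).
[cite: BuckmasterVicol2020, §7.4 (7.16a)] -/
def axialFn (hP : Periodic P 1) (n : d → ℤ) (r : ℝ) (y : UnitAddTorus d) : ℝ :=
  hP.lift (chi n y + ((r : ℝ) : UnitAddCircle))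

omit [DecidableEq d] in
/-- **The lift of the axial function**: `P̃(χ_n (proj Y) + r) = P(n·Y + r)`. [folklore] -/
theorem axialFn_proj (hP : Periodic P 1) (n : d → ℤ) (r : ℝ) (Y : EuclideanSpace ℝ d) :
    axialFn hP n r (proj Y) = P (∑ l, (n l : ℝ) * Y l + r) := by
  rw [axialFn, chi_proj, ← AddCircle.coe_add]
  rfl

omit [DecidableEq d] in
/-- The lift of the axial function as a function on `ℝ^d`. [folklore] -/
theorem lift_axialFn (hP : Periodic P 1) (n : d → ℤ) (r : ℝ) :
    lift (axialFn hP n r) = fun Y => P (∑ l, (n l : ℝ) * Y l + r) :=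
  funext fun Y => axialFn_proj hP n r Y

omit [DecidableEq d] in
/-- The linear form `Y ↦ n·Y` is smooth. [folklore] -/
theorem contDiff_dotForm (n : d → ℤ) {k : WithTop ℕ∞} :
    ContDiff ℝ k fun Y : EuclideanSpace ℝ d => ∑ l, (n l : ℝ) * Y l :=
  ContDiff.sum fun l _ => contDiff_const.mul (contDiff_euclidean.1 contDiff_id l)

omit [DecidableEq d] in
/-- The axial function of a smooth periodic `P` is smooth on `𝕋^d`. [folklore] -/
theorem isSmooth_axialFn (hP : Periodic P 1) (hPs : ContDiff ℝ ∞ P) (n : d → ℤ) (r : ℝ) :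
    IsSmooth (axialFn hP n r) := by
  unfold IsSmooth
  rw [lift_axialFn]
  exact hPs.comp ((contDiff_dotForm n).add contDiff_const)

omit [DecidableEq d] in
/-- `C^k` version. [folklore] -/
theorem isContDiff_axialFn (hP : Periodic P 1) {k : WithTop ℕ∞} (hPs : ContDiff ℝ k P) (n : d → ℤ) (r : ℝ) :
    IsContDiff k (axialFn hP n r) := by
  unfold IsContDiff
  rw [lift_axialFn]
  exact hPs.comp ((contDiff_dotForm n).add contDiff_const)

omit [Fintype d] [DecidableEq d] in
/-- The derivative of a `1`-periodic function is `1`-periodic. [folklore] -/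
theorem periodic_deriv (hP : Periodic P 1) : Periodic (deriv P) 1 := by
  intro x
  have h : (fun y => P (y + 1)) = P := funext hP
  rw [← deriv_comp_add_const, h]

/-- **Partial derivatives of the axial function**: `∂ₗ P̃(χ_n y + r) = nₗ · P̃'(χ_n y + r)`
(`P ∈ C¹`). [folklore] -/
theorem partialDeriv_axialFn (hP : Periodic P 1) (hPs : ContDiff ℝ 1 P) (n : d → ℤ) (r : ℝ) (l : d) (y : UnitAddTorus d) :
    Torus.partialDeriv l (axialFn hP n r) y = (n l : ℝ) * axialFn (periodic_deriv hP) n r y := by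
  obtain ⟨Y, rfl⟩ := proj_surjective y
  set c : ℝ := ∑ k, (n k : ℝ) * Y k + r with hc
  show deriv (fun t : ℝ => axialFn hP n r (proj Y + proj (t • EuclideanSpace.single l (1 : ℝ)))) 0 = _
  have hfun : (fun t : ℝ => axialFn hP n r (proj Y + proj (t • EuclideanSpace.single l (1 : ℝ)))) =
      P ∘ fun t => (n l : ℝ) * t + c := by
    funext t
    rw [← proj_add, axialFn_proj, Function.comp_apply, hc]
    congr 1
    simp only [PiLp.add_apply, PiLp.smul_apply, EuclideanSpace.single, PiLp.single_apply, smul_eq_mul, mul_add,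
      Finset.sum_add_distrib, mul_ite, mul_one, mul_zero, Finset.sum_ite_eq', Finset.mem_univ, if_true]
    ring
  have hin : HasDerivAt (fun t : ℝ => (n l : ℝ) * t + c) (n l : ℝ) 0 := by
    simpa using ((hasDerivAt_id (0 : ℝ)).const_mul (n l : ℝ)).add_const c
  have hP1 : HasDerivAt P (deriv P c) ((n l : ℝ) * 0 + c) := by
    rw [mul_zero, zero_add]
    exact (hPs.differentiable one_ne_zero).differentiableAt.hasDerivAt
  rw [hfun, (hP1.comp 0 hin).deriv, axialFn_proj, ← hc]
  ring

omit [DecidableEq d] in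
/-- **The phase derivative of the axial function**: `∂ᵣ P̃(χ_n y + r) = P̃'(χ_n y + r)`. [folklore] -/
theorem hasDerivAt_axialFn_phase (hP : Periodic P 1) (hPs : ContDiff ℝ 1 P) (n : d → ℤ) (y : UnitAddTorus d) (r : ℝ) :
    HasDerivAt (fun r' => axialFn hP n r' y) (axialFn (periodic_deriv hP) n r y) r := by
  obtain ⟨Y, rfl⟩ := proj_surjective y
  simp only [axialFn_proj]
  have hP1 : HasDerivAt P (deriv P (∑ l, (n l : ℝ) * Y l + r)) (∑ l, (n l : ℝ) * Y l + r) :=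
    (hPs.differentiable one_ne_zero).differentiableAt.hasDerivAt
  have hin : HasDerivAt (fun r' : ℝ => ∑ l, (n l : ℝ) * Y l + r') 1 r := by
    simpa using (hasDerivAt_id r).const_add (∑ l, (n l : ℝ) * Y l)
  simpa [Function.comp_def] using hP1.comp r hin

omit [DecidableEq d] in
/-- **Time-dependent phase**: `(t, Y) ↦ P(n·Y + w t)` is jointly smooth, i.e. the space–time lift of
`(t, y) ↦ P̃(χ_n y + wt)` is `C^∞`. [folklore] -/
theorem contDiff_stLift_axialFn (hP : Periodic P 1) (hPs : ContDiff ℝ ∞ P) (n : d → ℤ) (w : ℝ) :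
    ContDiff ℝ ∞ (stLift fun t y => axialFn hP n (w * t) y) := by
  have h : stLift (fun t y => axialFn hP n (w * t) y) =
      fun q : ℝ × EuclideanSpace ℝ d => P (∑ l, (n l : ℝ) * q.2 l + w * q.1) := by
    funext q
    rw [stLift_apply, axialFn_proj]
  rw [h]
  refine hPs.comp ?_
  exact ((contDiff_dotForm n).comp contDiff_snd).add (contDiff_const.mul contDiff_fst)

omit [DecidableEq d] in
/-- Pointwise bound: `|P̃(χ_n y + r)| ≤ B` if `|P| ≤ B`. [folklore] -/
theorem abs_axialFn_le (hP : Periodic P 1) {B : ℝ} (hB : ∀ s, |P s| ≤ B) (n : d → ℤ) (r : ℝ) (y : UnitAddTorus d) :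
    |axialFn hP n r y| ≤ B := by
  obtain ⟨Y, rfl⟩ := proj_surjective y
  rw [axialFn_proj]
  exact hB _

omit [DecidableEq d] in
/-- Integer dilation is absorbed into the lattice vector: `P̃(χ_n (σ • y) + r) = P̃(χ_{σn} y + r)`.
[folklore] -/
theorem axialFn_nsmul (hP : Periodic P 1) (n : d → ℤ) (r : ℝ) (σ : ℕ) (y : UnitAddTorus d) :
    axialFn hP n r (σ • y) = axialFn hP (fun l => (σ : ℤ) * n l) r y := by
  unfold axialFn
  congr 2
  simp only [chi_apply, Pi.smul_apply]
  refine Finset.sum_congr rfl fun l _ => ?_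
  rw [mul_zsmul, natCast_zsmul, smul_comm]

omit [DecidableEq d] in
/-- A translation of the argument is a shift of the phase: `P̃(χ_n (y - s) + r) = P̃(χ_n y + (r - ρ))`
whenever `χ_n s = ρ mod 1`. [folklore] -/
theorem axialFn_sub (hP : Periodic P 1) (n : d → ℤ) (r : ℝ) {s : UnitAddTorus d} {ρ : ℝ} (hs : chi n s = ((ρ : ℝ) : UnitAddCircle))
    (y : UnitAddTorus d) : axialFn hP n r (y - s) = axialFn hP n (r - ρ) y := by
  unfold axialFn
  congr 1
  rw [map_sub, hs, AddCircle.coe_sub]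
  abel

end Axial

/-! ## The joint homomorphism `y ↦ (χ_n y, L y)` and its Haar invariance -/

section Joint

variable {m : Type*} [Fintype m] [DecidableEq m]
variable (T : TransverseDatum d m) (n : d → ℤ)

/-- **The joint homomorphism** `𝕋^d →+ 𝕋¹ × 𝕋^m`, `y ↦ (χ_n y, L y)` (axial phase and transverse
coordinates of a jet). [folklore] -/
def jointHom : UnitAddTorus d →+ UnitAddCircle × UnitAddTorus m :=
  (chi n).prod T.hom

omit [DecidableEq d] in
/-- Unfolding the joint homomorphism. [folklore] -/
theorem jointHom_apply (y : UnitAddTorus d) : jointHom T n y = (chi n y, T.hom y) := rfl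

omit [DecidableEq d] in
/-- The character `χ_n` is continuous. [folklore] -/
theorem continuous_chi : Continuous (chi (d := d) n) := by
  have h : (chi n : UnitAddTorus d → UnitAddCircle) = fun y => ∑ l, n l • y l := funext (chi_apply n)
  rw [h]
  exact continuous_finsetSum _ fun l _ => (continuous_zsmul _).comp (continuous_apply l)

omit [DecidableEq d] in
/-- The joint homomorphism is continuous. [folklore] -/
theorem continuous_jointHom : Continuous (jointHom T n) :=
  (continuous_chi n).prodMk T.continuous_hom

omit [DecidableEq d] in
/-- Along the direction `k` the transverse forms vanish: `L (proj (t • k)) = 0`. [folklore] -/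
theorem hom_proj_smul_dir (t : ℝ) :
    T.hom (proj (t • WithLp.toLp 2 fun l => (T.k l : ℝ))) = 0 := by
  rw [TransverseDatum.hom_proj, map_smul, T.lin_dir, smul_zero]
  rfl

omit [DecidableEq d] in
/-- Along the direction `k` the character `χ_n` advances by `t (n·k)`. [folklore] -/
theorem chi_proj_smul_dir (t : ℝ) :
    chi n (proj (t • WithLp.toLp 2 fun l => (T.k l : ℝ))) = (((t * ∑ l, (n l : ℝ) * T.k l : ℝ)) : UnitAddCircle) := by
  rw [chi_proj]
  congr 1
  rw [Finset.mul_sum]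
  refine Finset.sum_congr rfl fun l _ => ?_
  simp only [PiLp.smul_apply, smul_eq_mul]
  ring

omit [DecidableEq d] in
/-- **Surjectivity of the joint homomorphism** when `n·k ≠ 0`: reach the transverse coordinates
with the integer section, then slide along `k`. [folklore] -/
theorem jointHom_surjective (hnk : ∑ l, (n l : ℝ) * T.k l ≠ 0) : Surjective (jointHom T n) := by
  rintro ⟨s, z⟩
  obtain ⟨y₀, hy₀⟩ := T.hom_surjective z
  obtain ⟨ρ, rfl⟩ := QuotientAddGroup.mk_surjective s
  obtain ⟨ρ₀, hρ₀⟩ := QuotientAddGroup.mk_surjective (chi n y₀)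
  set c : ℝ := ∑ l, (n l : ℝ) * T.k l with hc
  set t : ℝ := (ρ - ρ₀) / c with ht
  refine ⟨y₀ + proj (t • WithLp.toLp 2 fun l => (T.k l : ℝ)), ?_⟩
  rw [jointHom_apply, Prod.mk.injEq, map_add, map_add, hom_proj_smul_dir, add_zero, chi_proj_smul_dir,
    ← hρ₀, ← QuotientAddGroup.mk_add]
  refine ⟨?_, hy₀⟩
  congr 1
  rw [ht, div_mul_cancel₀ _ hnk]
  ring

/-- The product of the Haar probability measures on `𝕋¹ × 𝕋^m` is a Haar measure. [folklore] -/
instance isAddHaarMeasure_volume_prod :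
    (volume : Measure (UnitAddCircle × UnitAddTorus m)).IsAddHaarMeasure :=
  Measure.prod.instIsAddHaarMeasure (volume : Measure UnitAddCircle) (volume : Measure (UnitAddTorus m))

omit [DecidableEq d] in
/-- **`(χ_n, L)_* vol_{𝕋^d} = vol_{𝕋¹} ⊗ vol_{𝕋^m}`** for `n·k ≠ 0` (a continuous surjective
homomorphism of compact groups pushes the Haar probability measure to the Haar probability
measure). [folklore] -/
theorem map_jointHom_volume (hnk : ∑ l, (n l : ℝ) * T.k l ≠ 0) :
    Measure.map (jointHom T n) (volume : Measure (UnitAddTorus d)) = volume := by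
  have hm : Measurable (jointHom T n) := (continuous_jointHom T n).measurable
  haveI : (Measure.map (jointHom T n) (volume : Measure (UnitAddTorus d))).IsAddHaarMeasure :=
    Measure.isAddHaarMeasure_map_of_isFiniteMeasure (volume : Measure (UnitAddTorus d)) (jointHom T n)
      (continuous_jointHom T n) (jointHom_surjective T n hnk)
  haveI : IsProbabilityMeasure (Measure.map (jointHom T n) (volume : Measure (UnitAddTorus d))) :=
    Measure.isProbabilityMeasure_map hm.aemeasurable
  exact Measure.isAddHaarMeasure_eq_of_isProbabilityMeasure _ _

omit [DecidableEq d] in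
/-- The joint homomorphism is measure preserving (`n·k ≠ 0`). [folklore] -/
theorem measurePreserving_jointHom (hnk : ∑ l, (n l : ℝ) * T.k l ≠ 0) :
    MeasurePreserving (jointHom T n) (volume : Measure (UnitAddTorus d)) volume :=
  ⟨(continuous_jointHom T n).measurable, map_jointHom_volume T n hnk⟩

omit [DecidableEq d] in
/-- **Factorisation of torus integrals**: `∫_{𝕋^d} F(χ_n y) G(L y) dy = (∫_{𝕋¹} F)(∫_{𝕋^m} G)` for
`n·k ≠ 0` (BV 2019 survey, after (7.19): "we may use Fubini to combine the estimates obeyed by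
`ψ_(ξ)` … and `φ_(ξ)`"). [cite: BuckmasterVicol2020, §7.4] -/
theorem integral_axial_mul_transverse (hnk : ∑ l, (n l : ℝ) * T.k l ≠ 0) {F : UnitAddCircle → ℝ}
    (hF : AEStronglyMeasurable F volume) {G : UnitAddTorus m → ℝ} (hG : AEStronglyMeasurable G volume) :
    ∫ y, F (chi n y) * G (T.hom y) = (∫ s, F s) * ∫ z, G z := by
  have hvol : (volume : Measure (UnitAddCircle × UnitAddTorus m)) = (volume : Measure UnitAddCircle).prod volume := rfl
  have hg : AEStronglyMeasurable (fun q : UnitAddCircle × UnitAddTorus m => F q.1 * G q.2)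
      (Measure.map (jointHom T n) (volume : Measure (UnitAddTorus d))) := by
    rw [map_jointHom_volume T n hnk, hvol]
    exact hF.comp_fst.mul hG.comp_snd
  have h := integral_map (μ := (volume : Measure (UnitAddTorus d)))
    (continuous_jointHom T n).measurable.aemeasurable hg
  rw [map_jointHom_volume T n hnk] at h
  have h' : (fun y => F (chi n y) * G (T.hom y)) =
      fun y => (fun q : UnitAddCircle × UnitAddTorus m => F q.1 * G q.2) (jointHom T n y) := rfl
  rw [h', ← h, hvol, integral_prod_mul]

end Joint

/-! ## Circle integrals of lifts of periodic functions -/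

section CircleIntegral

variable {P : ℝ → ℝ}

omit [Fintype d] [DecidableEq d] in
/-- **`∫_{𝕋¹} F(P̃ s) ds = ∫₀¹ F(P s) ds`** for a `1`-periodic `P`. [folklore] -/
theorem integral_comp_lift_eq_intervalIntegral (hP : Periodic P 1) (F : ℝ → ℝ) :
    ∫ s : UnitAddCircle, F (hP.lift s) = ∫ s in (0 : ℝ)..1, F (P s) := by
  rw [← UnitAddCircle.intervalIntegral_preimage 0 (fun s => F (hP.lift s)), zero_add]
  rfl

omit [Fintype d] [DecidableEq d] in
/-- A phase shift does not change circle integrals: `∫_{𝕋¹} F(P̃(s + r)) ds = ∫₀¹ F(P s) ds`.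
[folklore] -/
theorem integral_comp_lift_add_eq_intervalIntegral (hP : Periodic P 1) (F : ℝ → ℝ) (r : ℝ) :
    ∫ s : UnitAddCircle, F (hP.lift (s + ((r : ℝ) : UnitAddCircle))) = ∫ s in (0 : ℝ)..1, F (P s) := by
  have h := integral_add_right_eq_self (μ := (volume : Measure UnitAddCircle))
    (fun s : UnitAddCircle => F (hP.lift s)) ((r : ℝ) : UnitAddCircle)
  rw [h]
  exact integral_comp_lift_eq_intervalIntegral hP F

variable {m : Type*} [Fintype m] [DecidableEq m]

omit [DecidableEq d] in
/-- **The jet factorisation**: `∫_{𝕋^d} F(P̃(χ_n y + r)) G(L y) dy = (∫₀¹ F(P s) ds)(∫_{𝕋^m} G)`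
(`n·k ≠ 0`). [cite: BuckmasterVicol2020, §7.4] -/
theorem integral_axialFn_mul_pull (hP : Periodic P 1) (hPc : Continuous P) (T : TransverseDatum d m) {n : d → ℤ}
    (hnk : ∑ l, (n l : ℝ) * T.k l ≠ 0) {F : ℝ → ℝ} (hF : Continuous F) {G : UnitAddTorus m → ℝ}
    (hG : AEStronglyMeasurable G volume) (r : ℝ) :
    ∫ y, F (axialFn hP n r y) * G (T.hom y) = (∫ s in (0 : ℝ)..1, F (P s)) * ∫ z, G z := by
  have h : (fun y => F (axialFn hP n r y) * G (T.hom y)) =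
      fun y => (fun s : UnitAddCircle => F (hP.lift (s + ((r : ℝ) : UnitAddCircle)))) (chi n y) * G (T.hom y) := rfl
  have hlift : Continuous hP.lift := by
    unfold Function.Periodic.lift
    exact hPc.quotient_liftOn' _
  have hFm : AEStronglyMeasurable (fun s : UnitAddCircle => F (hP.lift (s + ((r : ℝ) : UnitAddCircle)))) volume :=
    (hF.comp (hlift.comp (continuous_id.add continuous_const))).aestronglyMeasurable
  rw [h, integral_axial_mul_transverse T n hnk hFm hG, integral_comp_lift_add_eq_intervalIntegral]

omit [DecidableEq d] in
/-- The purely axial case: `∫_{𝕋^d} F(P̃(χ_n y + r)) dy = ∫₀¹ F(P s) ds` for `n ≠ 0` in the weak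
sense `n·k ≠ 0` for some transverse datum (always available for the directions of the geometric
lemma). [folklore] -/
theorem integral_axialFn (hP : Periodic P 1) (hPc : Continuous P) (T : TransverseDatum d m) {n : d → ℤ}
    (hnk : ∑ l, (n l : ℝ) * T.k l ≠ 0) {F : ℝ → ℝ} (hF : Continuous F) (r : ℝ) :
    ∫ y, F (axialFn hP n r y) = ∫ s in (0 : ℝ)..1, F (P s) := by
  have h := integral_axialFn_mul_pull hP hPc T hnk hF (G := fun _ => (1 : ℝ)) aestronglyMeasurable_const r
  simpa using h

end CircleIntegral

end Jet

end Literature.Analysis.FluidPDE
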